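import Literature.Analysis.FluidPDE.SteadyNSLatticePersistence
import Literature.Analysis.FunctionSpaces.TorusFourierMultipliers
import HarnessLib

/-!
# The linearised Navier–Stokes operator at the Kolmogorov shear flow on the unit cube has no
# steady (neutral, `μ = 0`) mode — at every amplitude and every viscosity

Analysis/FluidPDE proof file (theorems only; no definitions, no named facts).  For a smooth real field
`U : T³ → ℝ³` on the flat unit torus whose Fourier coefficients are supported on the two gravest wave
vectors `±e`, `e = (0,1,0)`, and are parallel to `e₀` — i.e. a single-harmonic unidirectional shear
`U(x) = (A sin(2πx₁ + φ), 0, 0)`, the Kolmogorov flow, which is an exact steady state of `NS_ν` under the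
force `4π²ν U` — the classical linearisation of `LinearizedNSTorus`,
`L(ν,U) w = νΔw − (U·∇)w − (w·∇)U − ∇q`, `div w = 0`, `∫ w = 0`, has trivial kernel for every `ν ≠ 0`:
`KolmogorovShear.not_isLinNSEigenvalue_shear : ¬ Torus.IsLinNSEigenvalue ν U 0`.

This is the (elementary) marginal case of the Meshalkin–Sinai analysis of the stability of the Kolmogorov
flow: on the torus of aspect ratio one with gravest forcing every streamwise wavenumber of a perturbation
is `≥` the forcing wavenumber, and no steady secondary mode bifurcates (Meshalkin–Sinai 1961; Iudovich 1965;
Marchioro 1986 for nonlinear stability on the square torus).  Only the absence of the eigenvalue `0` is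
proved here, by an explicit Fourier-side telescoping argument valid at all Reynolds numbers and for
three-dimensional perturbations:

* §1 lattice lemmas: convolutions (`ScalarFourier.lconv`) against families supported on `{e, −e}`, and the
  **telescoping lemma** `eq_zero_of_telescope` — if nonnegative reals `t k` satisfy
  `t k = β k₀ (z ζ(k−e) + z̄ ζ(k+e)) conj ζ(k)` with `β ∈ iℝ` and `ζ` rapidly decaying, then `t = 0` (the two
  lattice sums are complex conjugate after the shift `k ↦ k + e`, so the right side sums to `β · 2Re T ∈ iℝ`);
* §2 the dictionary: the convective and stretching symbols `N(Û, ŵ)`, `N(ŵ, Û)` of such a shear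
  (`SteadyLattice.mFourierCoeff_convect_complex`, `mFourierCoeff_stretch`) are two-term shifts in the
  direction `e`; the divergence constraint and the linearised equation coefficientwise;
* §3 elimination of the pressure with the divergence constraint gives for the wall-normal component the
  Orr–Sommerfeld recursion `−ν4π²|k|⁴ ŵ₁(k) = 2πi k₀ (z ζ(k−e) + z̄ ζ(k+e))`, `ζ = (|k|² − 1) ŵ₁`,
  `z = Û(e)₀`, whence `ŵ₁ = 0` by telescoping (`|k|⁴(|k|²−1)|ŵ₁(k)|²` has one sign); then `q̂ = 0` off
  `k = 0`, the tangential components obey the same recursion with `ζ = ŵ_p`, so `ŵ = 0` and `w = 0`.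

## Mathlib / tree search

Tree: `LinearizedNSTorus` (`Torus.IsLinNSEigenvalue`, `LinNSResolventRel`, `linearizedNSOperator`),
`SteadyNSLatticePersistence` §H (`mFourierCoeff_convect_complex`, `mFourierCoeff_stretch`,
`mFourierCoeff_gradientC`, `coeff_apply_complex`, `isSmooth_stretch`), `TorusFourierSynthesis`
(`RapidDecay`, `IsSmooth.rapidDecay_mFourierCoeff`, `eq_zero_of_forall_mFourierCoeff_eq_zero`,
`mFourierCoeff_laplacian`), `TorusFourierMultipliers` (`RapidDecay.transfer`), `ScalarFourierDefs`
(`lconv`, `dsym`, `transportSym`).  Mathlib: `tsum_eq_sum`, `Equiv.tsum_eq`, `Complex.conj_tsum`,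
`hasSum_zero_iff_of_nonneg`, `Complex.summable_ofReal`; no shear-flow spectral theory (searched
`Kolmogorov`, `Orr`, `Sommerfeld`: nothing relevant).

## References

* L. D. Meshalkin, Ia. G. Sinai, *Investigation of the stability of a stationary solution of a system of
  equations for the plane movement of an incompressible viscous liquid*, J. Appl. Math. Mech. (PMM) 25
  (1961) 1700–1705.
* V. I. Iudovich, *Example of the generation of a secondary stationary or periodic flow when there is loss
  of stability of the laminar flow of a viscous incompressible fluid*, J. Appl. Math. Mech. 29 (1965).
* C. Marchioro, *An example of absence of turbulence for any Reynolds number*, Comm. Math. Phys. 105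
  (1986) 99–106.
* P. G. Drazin, W. H. Reid, *Hydrodynamic Stability*, 2nd ed., CUP (2004), §25 (Orr–Sommerfeld), §31.
-/

noncomputable section

open scoped BigOperators ComplexConjugate
open Filter Set Function MeasureTheory UnitAddTorus Complex

namespace Literature.Analysis.FluidPDE

namespace KolmogorovShear

open Literature.Analysis.FunctionSpaces Literature.Analysis.FunctionSpaces.Torus
open Literature.Analysis.FunctionSpaces.EuclideanSpace
open Literature.Analysis.FluidPDE.ScalarFourier Literature.Analysis.FluidPDE.SteadyLattice

/-! ## §1 Lattice lemmas: sparse convolutions and the telescoping identity -/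

section Lattice

variable {d : Type*} [Fintype d]

/-- Lattice convolution with a left factor supported on `{e, −e}`. [folklore] -/
theorem lconv_of_support_pair {f g : (d → ℤ) → ℂ} {e : d → ℤ} (he : e ≠ -e)
    (hf : ∀ m, m ≠ e → m ≠ -e → f m = 0) (k : d → ℤ) :
    lconv f g k = f e * g (k - e) + f (-e) * g (k + e) := by
  rw [lconv_apply, tsum_eq_sum (s := ({e, -e} : Finset (d → ℤ))) (fun m hm => ?_),
    Finset.sum_pair he, sub_neg_eq_add]
  simp only [Finset.mem_insert, Finset.mem_singleton, not_or] at hm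
  rw [hf m hm.1 hm.2, zero_mul]

/-- Lattice convolution with a right factor supported on `{e, −e}`. [folklore] -/
theorem lconv_of_support_pair_right {f g : (d → ℤ) → ℂ} {e : d → ℤ} (he : e ≠ -e)
    (hg : ∀ m, m ≠ e → m ≠ -e → g m = 0) (k : d → ℤ) :
    lconv f g k = f (k - e) * g e + f (k + e) * g (-e) := by
  rw [lconv_apply]
  have h : ∑' m, f m * g (k - m) = ∑' m, f (k - m) * g m := by
    rw [← (Equiv.subLeft k).tsum_eq (fun m => f (k - m) * g m)]
    exact tsum_congr fun m => by simp [Equiv.subLeft_apply]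
  rw [h, tsum_eq_sum (s := ({e, -e} : Finset (d → ℤ))) (fun m hm => ?_), Finset.sum_pair he,
    sub_neg_eq_add]
  simp only [Finset.mem_insert, Finset.mem_singleton, not_or] at hm
  rw [hg m hm.1 hm.2, mul_zero]



/-- A rapidly decaying scalar family is bounded by its `ℓ¹` norm. [folklore] -/
theorem norm_le_tsum_norm {ζ : (d → ℤ) → ℂ} (hζ : RapidDecay ζ) (m : d → ℤ) :
    ‖ζ m‖ ≤ ∑' k, ‖ζ k‖ :=
  hζ.summable_norm.le_tsum m (fun _ _ => norm_nonneg _)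

/-- Summability of the "transfer" products `α(k) ζ(k + k₀) conj ζ(k)` for a rapidly decaying `ζ`
and a weight `α` of polynomial growth. [folklore] -/
theorem summable_transfer {ζ : (d → ℤ) → ℂ} (hζ : RapidDecay ζ) (k₀ : d → ℤ) {α : (d → ℤ) → ℝ}
    {C : ℝ} {s : ℕ} (hα : ∀ k, |α k| ≤ C * (1 + freqNormSq k) ^ s) (w : ℂ) :
    Summable fun k => (α k : ℂ) * w * ζ (k + k₀) * conj (ζ k) := by
  set M : ℝ := ∑' k, ‖ζ k‖ with hM
  refine Summable.of_norm_bounded (g := fun k => (‖w‖ * M * C) * ((1 + freqNormSq k) ^ s * ‖ζ k‖))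
    ((hζ s).mul_left _) fun k => ?_
  have h1 : ‖ζ (k + k₀)‖ ≤ M := norm_le_tsum_norm hζ _
  have h2 : |α k| ≤ C * (1 + freqNormSq k) ^ s := hα k
  have hM0 : 0 ≤ M := tsum_nonneg fun _ => norm_nonneg _
  calc ‖(α k : ℂ) * w * ζ (k + k₀) * conj (ζ k)‖
      = |α k| * ‖w‖ * ‖ζ (k + k₀)‖ * ‖ζ k‖ := by
        simp only [norm_mul, Complex.norm_real, Real.norm_eq_abs, Complex.norm_conj]
    _ ≤ (C * (1 + freqNormSq k) ^ s) * ‖w‖ * M * ‖ζ k‖ := by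
        have hC : 0 ≤ C * (1 + freqNormSq k) ^ s := (abs_nonneg _).trans h2
        gcongr
    _ = (‖w‖ * M * C) * ((1 + freqNormSq k) ^ s * ‖ζ k‖) := by ring

/-- **Telescoping lemma.** If nonnegative reals `t k` satisfy, for a rapidly decaying `ζ`, a
`k₀`-periodic real weight `α` of polynomial growth, and constants `β, z ∈ ℂ` with `β` purely imaginary,
`t k = β α(k) (z ζ(k − k₀) + conj z ζ(k + k₀)) conj ζ(k)` for all `k`, then `t = 0`: the sum over `k`
of the right-hand side is `β · 2 Re T`, `T = ∑ α conj z ζ(· + k₀) conj ζ`, hence purely imaginary,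
while the left-hand side sums to a nonnegative real. [folklore] -/
theorem eq_zero_of_telescope {ζ : (d → ℤ) → ℂ} (hζ : RapidDecay ζ) (k₀ : d → ℤ) {α : (d → ℤ) → ℝ}
    {C : ℝ} {s : ℕ} (hαper : ∀ k, α (k + k₀) = α k)
    (hα : ∀ k, |α k| ≤ C * (1 + freqNormSq k) ^ s)
    {β : ℂ} (hβ : β.re = 0) (z : ℂ) {t : (d → ℤ) → ℝ} (ht : ∀ k, 0 ≤ t k)
    (heq : ∀ k, (t k : ℂ) = β * ((α k : ℂ) * (z * ζ (k - k₀) + conj z * ζ (k + k₀)) * conj (ζ k))) :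
    ∀ k, t k = 0 := by
  -- the two halves of the right-hand side
  set P : (d → ℤ) → ℂ := fun k => (α k : ℂ) * conj z * ζ (k + k₀) * conj (ζ k) with hP
  set Q : (d → ℤ) → ℂ := fun k => (α k : ℂ) * z * ζ (k - k₀) * conj (ζ k) with hQ
  have hPs : Summable P := summable_transfer hζ k₀ hα (conj z)
  have hQP : ∀ k, Q k = conj (P (k - k₀)) := by
    intro k
    have hαk : α (k - k₀) = α k := by rw [← hαper (k - k₀), sub_add_cancel]
    simp only [hP, hQ, map_mul, Complex.conj_ofReal, Complex.conj_conj, sub_add_cancel, hαk]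
    ring
  have hQs : Summable Q := by
    have h1 : Summable fun k => P (k - k₀) :=
      (Equiv.subRight k₀).summable_iff.2 hPs
    have h2 : Summable fun k => conj (P (k - k₀)) :=
      (Complex.conjCLE.summable (f := fun k => P (k - k₀))).2 h1
    exact h2.congr fun k => (hQP k).symm
  have hQsum : ∑' k, Q k = conj (∑' k, P k) := by
    rw [Complex.conj_tsum, ← (Equiv.subRight k₀).tsum_eq (fun k => conj (P k))]
    exact tsum_congr fun k => hQP k
  -- the complexified left-hand side is summable with purely imaginary sum
  have heq' : ∀ k, (t k : ℂ) = β * (Q k + P k) := by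
    intro k; rw [heq k]; simp only [hP, hQ]; ring
  have hts : Summable fun k => (t k : ℂ) := by
    have := ((hQs.add hPs).mul_left β)
    exact this.congr fun k => (heq' k).symm
  have htsum : ∑' k, (t k : ℂ) = β * (conj (∑' k, P k) + ∑' k, P k) := by
    rw [tsum_congr heq', tsum_mul_left, hQs.tsum_add hPs, hQsum]
  have hre : (∑' k, t k) = 0 := by
    have h1 : ((∑' k, t k : ℝ) : ℂ) = β * (conj (∑' k, P k) + ∑' k, P k) := by
      rw [Complex.ofReal_tsum]; exact htsum
    have h2 := congrArg Complex.re h1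
    have h3 : (conj (∑' k, P k) + ∑' k, P k).im = 0 := by
      rw [Complex.add_im, Complex.conj_im]; ring
    rw [Complex.ofReal_re, Complex.mul_re, hβ, zero_mul, zero_sub, h3, mul_zero, neg_zero] at h2
    exact h2
  have hsum : Summable t := Complex.summable_ofReal.1 hts
  have h0 : HasSum t 0 := hre ▸ hsum.hasSum
  have := (hasSum_zero_iff_of_nonneg ht).1 h0
  exact fun k => congrFun this k


end Lattice

/-! ## §2–§3 The shear symbols, the Fourier-side equations, and the kernel -/

section Symbols


/-- **The convective symbol `N(â, ĉ)` of a single-harmonic unidirectional shear**: if `a` is supported on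
`{e, −e}` with `e₀ = 0` and parallel to `e₀`, then
`N(a, c)(k)_p = 2πi k₀ (a(e)₀ c(k−e)_p + a(−e)₀ c(k+e)_p)`. [folklore] -/
theorem transportSym_shear_left {a c : (Fin 3 → ℤ) → EuclideanSpace ℂ (Fin 3)} {e : Fin 3 → ℤ}
    (he : e ≠ -e) (he0 : e 0 = 0) (hsupp : ∀ m, m ≠ e → m ≠ -e → a m = 0)
    (hdir : ∀ m (j : Fin 3), j ≠ 0 → a m j = 0) (k : Fin 3 → ℤ) (p : Fin 3) :
    transportSym (fun j m => a m j) (fun m => c m p) k =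
      dsym 0 k * (a e 0 * c (k - e) p + a (-e) 0 * c (k + e) p) := by
  rw [transportSym_apply, Fin.sum_univ_three]
  have h0 : ∀ j, j ≠ 0 → lconv (fun m => a m j) (fun m => dsym j m * c m p) k = 0 := fun j hj => by
    rw [lconv_apply]; simp [hdir _ j hj]
  rw [h0 1 one_ne_zero, h0 2 (by decide), add_zero, add_zero,
    lconv_of_support_pair he (fun m h1 h2 => by rw [hsupp m h1 h2]; rfl) k]
  have h1 : dsym 0 (k - e) = dsym 0 k := by simp [dsym_apply, he0]
  have h2 : dsym 0 (k + e) = dsym 0 k := by simp [dsym_apply, he0]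
  rw [h1, h2]; ring

/-- **The stretching symbol `N(ĉ, â)` of a single-harmonic unidirectional shear** (`e = (0,1,0)`):
`N(c, a)(k)₀ = 2πi (a(e)₀ c(k−e)₁ − a(−e)₀ c(k+e)₁)`. [folklore] -/
theorem transportSym_shear_right {a c : (Fin 3 → ℤ) → EuclideanSpace ℂ (Fin 3)} {e : Fin 3 → ℤ}
    (he : e ≠ -e) (he0 : e 0 = 0) (he1 : e 1 = 1) (he2 : e 2 = 0)
    (hsupp : ∀ m, m ≠ e → m ≠ -e → a m = 0) (k : Fin 3 → ℤ) :
    transportSym (fun j m => c m j) (fun m => a m 0) k =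
      2 * Real.pi * I * (a e 0 * c (k - e) 1 - a (-e) 0 * c (k + e) 1) := by
  rw [transportSym_apply]
  have h : ∀ j, lconv (fun m => c m j) (fun m => dsym j m * a m 0) k =
      c (k - e) j * (dsym j e * a e 0) + c (k + e) j * (dsym j (-e) * a (-e) 0) :=
    fun j => lconv_of_support_pair_right he (fun m h1 h2 => by rw [hsupp m h1 h2]; simp) k
  rw [Fin.sum_univ_three, h 0, h 1, h 2]
  simp only [dsym_apply, Pi.neg_apply, he0, he1, he2]
  push_cast; ring

/-- The stretching symbol has no component transversal to the shear direction. [folklore] -/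
theorem transportSym_shear_right_of_ne {a c : (Fin 3 → ℤ) → EuclideanSpace ℂ (Fin 3)}
    (hdir : ∀ m (j : Fin 3), j ≠ 0 → a m j = 0) (k : Fin 3 → ℤ) {p : Fin 3} (hp : p ≠ 0) :
    transportSym (fun j m => c m j) (fun m => a m p) k = 0 := by
  rw [transportSym_apply]
  refine Finset.sum_eq_zero fun j _ => ?_
  rw [lconv_apply]; simp [hdir _ p hp]

/-- **Fourier coefficients of the divergence constraint**: a smooth divergence-free complex field has
transversal coefficients, `k · ŵ(k) = 0`. [folklore] -/
theorem kdot_mFourierCoeff_eq_zero {w : UnitAddTorus (Fin 3) → EuclideanSpace ℂ (Fin 3)} (hw : IsSmooth w)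
    (hdiv : Torus.IsDivFreeC w) (k : Fin 3 → ℤ) : ∑ p, ((k p : ℤ) : ℂ) * mFourierCoeff w k p = 0 := by
  set Dv : UnitAddTorus (Fin 3) → ℂ := fun x => ∑ l, Torus.partialDeriv l (fun y => w y l) x with hDv
  have hwl : ∀ l, IsSmooth (fun x => w x l) := fun l =>
    hw.comp_clm ((EuclideanSpace.proj l : EuclideanSpace ℂ (Fin 3) →L[ℂ] ℂ).restrictScalars ℝ)
  have hD0 : Dv = fun _ => (0 : ℂ) := funext fun x => hdiv x
  have hcoeff : mFourierCoeff Dv k = 2 * Real.pi * I * ∑ p, ((k p : ℤ) : ℂ) * mFourierCoeff w k p := by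
    rw [hDv, mFourierCoeff_finset_sum (f := fun l => Torus.partialDeriv l (fun x => w x l)) _
      (fun l _ => ((hwl l).partialDeriv l).integrable), Finset.mul_sum]
    refine Finset.sum_congr rfl fun l _ => ?_
    rw [mFourierCoeff_partialDeriv (hwl l) l k, coeff_apply_complex hw k l, smul_eq_mul]
    ring
  have hz : mFourierCoeff Dv k = 0 := by
    rw [hD0, mFourierCoeff_eq_integral_volume]
    simp
  rw [hz] at hcoeff
  have hI : (2 * Real.pi * I : ℂ) ≠ 0 :=
    mul_ne_zero (mul_ne_zero two_ne_zero (by exact_mod_cast Real.pi_ne_zero)) I_ne_zero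
  exact (mul_eq_zero.1 hcoeff.symm).resolve_left hI

/-- **The linearised equation in Fourier variables, componentwise**: if `L(ν,U)(w,q) = 0` classically then
`−ν4π²|k|² ŵ(k)_p − (N(Û,ŵ)(k)_p + N(ŵ,Û)(k)_p) − 2πi q̂(k) k_p = 0`. [folklore] -/
theorem fourier_eq_of_linearizedNSOperator_eq_zero {ν : ℝ} {U : UnitAddTorus (Fin 3) → EuclideanSpace ℝ (Fin 3)}
    (hU : IsSmooth U) {w : UnitAddTorus (Fin 3) → EuclideanSpace ℂ (Fin 3)} {q : UnitAddTorus (Fin 3) → ℂ}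
    (hw : IsSmooth w) (hq : IsSmooth q)
    (hE : ∀ x, Torus.linearizedNSOperator ν U w q x = 0) (k : Fin 3 → ℤ) (p : Fin 3) :
    -((ν * (4 * Real.pi ^ 2 * freqNormSq k) : ℝ) : ℂ) * mFourierCoeff w k p -
      (transportSym (fun j m => mFourierCoeff (complexify ∘ U) m j) (fun m => mFourierCoeff w m p) k +
        transportSym (fun j m => mFourierCoeff w m j) (fun m => mFourierCoeff (complexify ∘ U) m p) k) -
      2 * Real.pi * I * mFourierCoeff q k * (k p : ℂ) = 0 := by
  have i1 : Integrable (fun y => laplacian w y) volume := hw.laplacian.integrable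
  have i1' : Integrable ((ν : ℂ) • fun y => laplacian w y) volume := i1.smul (ν : ℂ)
  have i2 : Integrable (Torus.convect U w) volume := (hU.convect hw).integrable
  have i3 : Integrable (Torus.stretch w U) volume := (isSmooth_stretch hU hw).integrable
  have i4 : Integrable (Torus.gradientC q) volume := by
    refine Continuous.integrable_unitAddTorus ?_
    exact (PiLp.continuous_toLp 2 _).comp (continuous_pi fun l => (hq.partialDeriv l).continuous)
  have hfun : (fun y => Torus.linearizedNSOperator ν U w q y) =
      ((ν : ℂ) • fun y => laplacian w y) - (Torus.convect U w + Torus.stretch w U) - Torus.gradientC q := by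
    funext y
    simp only [Torus.linearizedNSOperator_apply, Pi.sub_apply, Pi.add_apply, Pi.smul_apply, Complex.coe_smul]
  have hzero : (fun y => Torus.linearizedNSOperator ν U w q y) = fun _ => (0 : EuclideanSpace ℂ (Fin 3)) := funext hE
  have hk : mFourierCoeff (fun y => Torus.linearizedNSOperator ν U w q y) k = 0 := by
    rw [hzero, mFourierCoeff_eq_integral_volume]; simp
  rw [hfun, mFourierCoeff_sub (i1'.sub (i2.add i3)) i4, mFourierCoeff_sub i1' (i2.add i3), mFourierCoeff_add i2 i3,
    mFourierCoeff_const_smul, mFourierCoeff_convect_complex hU hw k, mFourierCoeff_stretch hU hw k,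
    mFourierCoeff_gradientC hq k, show (fun y => laplacian w y) = laplacian w from rfl,
    Torus.mFourierCoeff_laplacian hw k] at hk
  have h := congrArg (fun v : EuclideanSpace ℂ (Fin 3) => v p) hk
  simp only [PiLp.sub_apply, PiLp.add_apply, PiLp.smul_apply, PiLp.neg_apply, smul_eq_mul,
    Torus.freqVec_apply, PiLp.zero_apply] at h
  rw [← h]
  push_cast
  ring

/-- **Tangential components.** If a rapidly decaying transversal family `c` with `c 0 = 0` satisfies the
shear recursion `−ν·4π²|k|² c(k)_p = 2πi k₀ (z c(k−e)_p + conj z c(k+e)_p)` (`e₀ = 0`, `ν ≠ 0`), then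
`c(·)_p = 0`: multiply by `conj c(k)_p` and telescope. [folklore] -/
theorem component_eq_zero {ν : ℝ} (hν : ν ≠ 0) {c : (Fin 3 → ℤ) → EuclideanSpace ℂ (Fin 3)}
    (hcr : RapidDecay c) (hc0 : c 0 = 0) {e : Fin 3 → ℤ} (he0 : e 0 = 0) (z : ℂ) (p : Fin 3)
    (h : ∀ k, -(ν : ℂ) * (4 * Real.pi ^ 2 * ((freqNormSq k : ℝ) : ℂ)) * c k p =
      2 * Real.pi * I * (k 0 : ℂ) * (z * c (k - e) p + conj z * c (k + e) p)) :
    ∀ k, c k p = 0 := by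
  -- telescoping data
  set ζ : (Fin 3 → ℤ) → ℂ := fun m => c m p with hζ
  set t : (Fin 3 → ℤ) → ℝ := fun k => freqNormSq k * ‖c k p‖ ^ 2 with ht
  have hζr : RapidDecay ζ :=
    hcr.transfer (C := 1) (s := 0) fun k => by
      simpa [hζ] using norm_apply_le_norm' (c k) p
  have hαper : ∀ k : Fin 3 → ℤ, (((k + e) 0 : ℤ) : ℝ) = ((k 0 : ℤ) : ℝ) := fun k => by simp [he0]
  have hα : ∀ k : Fin 3 → ℤ, |((k 0 : ℤ) : ℝ)| ≤ 1 * (1 + freqNormSq k) ^ 1 := fun k => by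
    simpa using abs_apply_le_one_add_freqNormSq k 0
  set β : ℂ := 2 * Real.pi * I / (-(4 * Real.pi ^ 2 * ν)) with hβ
  have hden : (-(4 * Real.pi ^ 2 * ν) : ℂ) ≠ 0 := by
    have hπ : (Real.pi : ℂ) ≠ 0 := by exact_mod_cast Real.pi_ne_zero
    have hν' : (ν : ℂ) ≠ 0 := by exact_mod_cast hν
    exact neg_ne_zero.2 (mul_ne_zero (mul_ne_zero (by norm_num) (pow_ne_zero 2 hπ)) hν')
  have hβre : β.re = 0 := by
    have : β = ((2 * Real.pi / (-(4 * Real.pi ^ 2 * ν)) : ℝ) : ℂ) * I := by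
      rw [hβ]; push_cast; ring
    rw [this]
    simp only [Complex.mul_re, Complex.ofReal_re, Complex.ofReal_im, Complex.I_re, Complex.I_im, mul_zero,
      zero_mul, sub_zero]
  have ht0 : ∀ k, 0 ≤ t k := fun k => mul_nonneg (freqNormSq_nonneg k) (sq_nonneg _)
  have heq : ∀ k, (t k : ℂ) =
      β * ((((k 0 : ℤ) : ℝ) : ℂ) * (z * ζ (k - e) + conj z * ζ (k + e)) * conj (ζ k)) := by
    intro k
    have hsq : ((‖c k p‖ : ℝ) : ℂ) ^ 2 = c k p * conj (c k p) := by
      rw [Complex.mul_conj, Complex.normSq_eq_norm_sq, Complex.ofReal_pow]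
    rw [hβ, div_mul_eq_mul_div, eq_div_iff hden, ht]
    simp only [hζ]
    push_cast
    rw [hsq]
    linear_combination conj (c k p) * h k
  have htz := eq_zero_of_telescope hζr e hαper hα hβre z ht0 heq
  -- conclusion
  intro k
  by_cases hk : k = 0
  · rw [hk, hc0]; rfl
  · have h1 : freqNormSq k * ‖c k p‖ ^ 2 = 0 := htz k
    have hK : freqNormSq k ≠ 0 := fun h0 => hk ((Torus.freqNormSq_eq_zero_iff k).1 h0)
    have h2 : ‖c k p‖ ^ 2 = 0 := (mul_eq_zero.1 h1).resolve_left hK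
    exact norm_eq_zero.1 (pow_eq_zero_iff two_ne_zero |>.1 h2)

/-- **The normal component (Orr–Sommerfeld).** If a rapidly decaying family `c` with `c 0 = 0` satisfies
`−ν·4π²|k|⁴ c(k)₁ = 2πi k₀ (z ζ(k−e) + conj z ζ(k+e))`, `ζ(m) = (|m|² − 1) c(m)₁` (`e₀ = 0`, `ν ≠ 0`),
then `c(·)₁ = 0`: multiplying by `conj ζ(k)` and telescoping gives `|k|⁴(|k|²−1)|c(k)₁|² = 0`, whence
`ζ = 0`, and then the recursion itself gives `c(k)₁ = 0`. [folklore] -/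
theorem normal_component_eq_zero {ν : ℝ} (hν : ν ≠ 0) {c : (Fin 3 → ℤ) → EuclideanSpace ℂ (Fin 3)}
    (hcr : RapidDecay c) (hc0 : c 0 = 0) {e : Fin 3 → ℤ} (he0 : e 0 = 0) (z : ℂ)
    (h : ∀ k, -(ν : ℂ) * (4 * Real.pi ^ 2 * ((freqNormSq k : ℝ) : ℂ)) * ((freqNormSq k : ℝ) : ℂ) * c k 1 =
      2 * Real.pi * I * (k 0 : ℂ) *
        (z * (((freqNormSq (k - e) : ℝ) : ℂ) - 1) * c (k - e) 1 +
          conj z * (((freqNormSq (k + e) : ℝ) : ℂ) - 1) * c (k + e) 1)) :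
    ∀ k, c k 1 = 0 := by
  set ζ : (Fin 3 → ℤ) → ℂ := fun m => ((freqNormSq m - 1 : ℝ) : ℂ) * c m 1 with hζ
  set t : (Fin 3 → ℤ) → ℝ := fun k => freqNormSq k ^ 2 * ((freqNormSq k - 1) * ‖c k 1‖ ^ 2) with ht
  have hζr : RapidDecay ζ := by
    refine hcr.transfer (C := 1) (s := 1) fun k => ?_
    rw [hζ]
    dsimp only
    rw [norm_mul, Complex.norm_real, Real.norm_eq_abs, one_mul, pow_one]
    refine mul_le_mul ?_ (norm_apply_le_norm' (c k) 1) (norm_nonneg _) ?_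
    · have := freqNormSq_nonneg k
      rw [abs_le]; constructor <;> linarith
    · linarith [freqNormSq_nonneg k]
  have hαper : ∀ k : Fin 3 → ℤ, (((k + e) 0 : ℤ) : ℝ) = ((k 0 : ℤ) : ℝ) := fun k => by simp [he0]
  have hα : ∀ k : Fin 3 → ℤ, |((k 0 : ℤ) : ℝ)| ≤ 1 * (1 + freqNormSq k) ^ 1 := fun k => by
    simpa using abs_apply_le_one_add_freqNormSq k 0
  set β : ℂ := 2 * Real.pi * I / (-(4 * Real.pi ^ 2 * ν)) with hβ
  have hπ : (Real.pi : ℂ) ≠ 0 := by exact_mod_cast Real.pi_ne_zero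
  have hν' : (ν : ℂ) ≠ 0 := by exact_mod_cast hν
  have hden : (-(4 * Real.pi ^ 2 * ν) : ℂ) ≠ 0 :=
    neg_ne_zero.2 (mul_ne_zero (mul_ne_zero (by norm_num) (pow_ne_zero 2 hπ)) hν')
  have hβre : β.re = 0 := by
    have : β = ((2 * Real.pi / (-(4 * Real.pi ^ 2 * ν)) : ℝ) : ℂ) * I := by
      rw [hβ]; push_cast; ring
    rw [this]
    simp only [Complex.mul_re, Complex.ofReal_re, Complex.ofReal_im, Complex.I_re, Complex.I_im, mul_zero,
      zero_mul, sub_zero]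
  -- the terms `t k` are nonnegative: `|k|² ≥ 1` unless `k = 0`
  have ht0 : ∀ k, 0 ≤ t k := by
    intro k
    by_cases hk : k = 0
    · rw [ht, hk]; simp [freqNormSq_zero]
    · have h1 : 1 ≤ freqNormSq k := Torus.one_le_freqNormSq hk
      exact mul_nonneg (sq_nonneg _) (mul_nonneg (by linarith) (sq_nonneg _))
  have heq : ∀ k, (t k : ℂ) =
      β * ((((k 0 : ℤ) : ℝ) : ℂ) * (z * ζ (k - e) + conj z * ζ (k + e)) * conj (ζ k)) := by
    intro k
    have hsq : ((‖c k 1‖ : ℝ) : ℂ) ^ 2 = c k 1 * conj (c k 1) := by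
      rw [Complex.mul_conj, Complex.normSq_eq_norm_sq, Complex.ofReal_pow]
    have hcζ : conj (ζ k) = ((freqNormSq k - 1 : ℝ) : ℂ) * conj (c k 1) := by
      rw [hζ]; dsimp only; rw [map_mul, Complex.conj_ofReal]
    rw [hβ, div_mul_eq_mul_div, eq_div_iff hden, ht, hcζ]
    simp only [hζ]
    push_cast
    rw [hsq]
    linear_combination (((freqNormSq k : ℝ) : ℂ) - 1) * conj (c k 1) * h k
  have htz := eq_zero_of_telescope hζr e hαper hα hβre z ht0 heq
  -- `ζ = 0`
  have hζ0 : ∀ m, ζ m = 0 := by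
    intro m
    by_cases hm : m = 0
    · simp only [hζ, hm, hc0, PiLp.zero_apply, mul_zero]
    · have h1 : freqNormSq m ^ 2 * ((freqNormSq m - 1) * ‖c m 1‖ ^ 2) = 0 := htz m
      have hK : freqNormSq m ≠ 0 := fun h0 => hm ((Torus.freqNormSq_eq_zero_iff m).1 h0)
      have h2 : (freqNormSq m - 1) * ‖c m 1‖ ^ 2 = 0 := (mul_eq_zero.1 h1).resolve_left (pow_ne_zero 2 hK)
      rcases mul_eq_zero.1 h2 with h3 | h3
      · rw [hζ]; dsimp only; rw [h3]; simp
      · have : c m 1 = 0 := norm_eq_zero.1 (pow_eq_zero_iff two_ne_zero |>.1 h3)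
        rw [hζ]; dsimp only; rw [this, mul_zero]
  -- hence the recursion collapses
  intro k
  by_cases hk : k = 0
  · rw [hk, hc0]; rfl
  · have hK : ((freqNormSq k : ℝ) : ℂ) ≠ 0 := by
      exact_mod_cast fun h0 => hk ((Torus.freqNormSq_eq_zero_iff k).1 h0)
    have h1 := h k
    have e1 : (((freqNormSq (k - e) : ℝ) : ℂ) - 1) * c (k - e) 1 = ζ (k - e) := by
      rw [hζ]; push_cast; ring
    have e2 : (((freqNormSq (k + e) : ℝ) : ℂ) - 1) * c (k + e) 1 = ζ (k + e) := by
      rw [hζ]; push_cast; ring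
    rw [mul_assoc z, mul_assoc (conj z), e1, e2, hζ0, hζ0, mul_zero, mul_zero, add_zero, mul_zero] at h1
    have hcoef : -(ν : ℂ) * (4 * Real.pi ^ 2 * ((freqNormSq k : ℝ) : ℂ)) * ((freqNormSq k : ℝ) : ℂ) ≠ 0 :=
      mul_ne_zero (mul_ne_zero (neg_ne_zero.2 hν') (mul_ne_zero (mul_ne_zero (by norm_num) (pow_ne_zero 2 hπ)) hK)) hK
    exact (mul_eq_zero.1 h1).resolve_left hcoef

/-- **No neutral steady mode of the Kolmogorov (gravest single-harmonic) shear flow on the unit cube, at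
every amplitude and every viscosity.**  Let `U : T³ → ℝ³` be smooth with Fourier support in `{±e}`,
`e = (0,1,0)`, and values parallel to `e₀` — i.e. `U(x) = (A sin(2πx₁ + φ), 0, 0)`.  Then for `ν ≠ 0`
the classical linearisation `L(ν,U) w = νΔw − (U·∇)w − (w·∇)U − ∇q`, `div w = 0`, `∫ w = 0`, has trivial
kernel: `¬ IsLinNSEigenvalue ν U 0`.  Proof on the Fourier side: eliminating the pressure with the
divergence constraint gives for the normal component the Orr–Sommerfeld recursion
`−ν4π²|k|⁴ ŵ₁(k) = 2πi k₀ (z ζ(k−e) + z̄ ζ(k+e))`, `ζ = (|k|²−1)ŵ₁`, `z = Û(e)₀`; multiplied by `conj ζ(k)`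
and summed over `ℤ³` the right side is purely imaginary (the two sums are conjugate after the shift
`k ↦ k + e`) and the left side is real of one sign, so `ŵ₁ = 0`; then `q̂ = 0` off `k = 0` and the two
tangential components satisfy the same recursion with `ζ = ŵ_p`.  (The square torus with gravest forcing
is the stable case `α ≥ 1` of Meshalkin–Sinai 1961; here only the absence of the eigenvalue `0` in the
mean-zero class is asserted, for all Reynolds numbers.) [folklore] -/
theorem not_isLinNSEigenvalue_shear {ν : ℝ} (hν : ν ≠ 0) {U : UnitAddTorus (Fin 3) → EuclideanSpace ℝ (Fin 3)}
    (hU : IsSmooth U)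
    (hsupp : ∀ m, m ≠ Pi.single 1 1 → m ≠ -Pi.single 1 1 → mFourierCoeff (complexify ∘ U) m = 0)
    (hdir : ∀ m (j : Fin 3), j ≠ 0 → mFourierCoeff (complexify ∘ U) m j = 0) :
    ¬ Torus.IsLinNSEigenvalue ν U 0 := by
  rintro ⟨w, hw0, hw, hdivC, hmean, q, hq, hE⟩
  -- names for the wave vector and the three coefficient families
  obtain ⟨e, he⟩ : ∃ e : Fin 3 → ℤ, e = Pi.single 1 1 := ⟨_, rfl⟩
  have hcs : IsConjSymm (fun k => mFourierCoeff (complexify ∘ U) k) := isConjSymm_mFourierCoeff hU.integrable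
  obtain ⟨a, ha⟩ : ∃ a, mFourierCoeff (complexify ∘ U) = a := ⟨_, rfl⟩
  obtain ⟨c, hc⟩ : ∃ c, mFourierCoeff w = c := ⟨_, rfl⟩
  obtain ⟨Q, hQ⟩ : ∃ Q, mFourierCoeff q = Q := ⟨_, rfl⟩
  rw [← he] at hsupp
  rw [ha] at hsupp hdir hcs
  have he0 : e 0 = 0 := by rw [he]; simp
  have he1 : e 1 = 1 := by rw [he]; simp
  have he2 : e 2 = 0 := by rw [he]; simp
  have hene : e ≠ -e := by
    intro h
    have h1 := congrFun h 1
    rw [Pi.neg_apply, he1] at h1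
    norm_num at h1
  obtain ⟨z, hz⟩ : ∃ z : ℂ, a e 0 = z := ⟨_, rfl⟩
  have haz : a (-e) 0 = conj z := by
    have h := hcs e
    dsimp only at h
    rw [h, conjVec_apply, hz]
  -- decay, mean, transversality of `ŵ`
  have hcr : RapidDecay c := hc ▸ hw.rapidDecay_mFourierCoeff
  have hc0 : c 0 = 0 := hc ▸ mFourierCoeff_zero_of_hasZeroMean hmean
  have hct : ∀ k : Fin 3 → ℤ,
      ((k 0 : ℤ) : ℂ) * c k 0 + ((k 1 : ℤ) : ℂ) * c k 1 + ((k 2 : ℤ) : ℂ) * c k 2 = 0 := by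
    intro k
    have h := kdot_mFourierCoeff_eq_zero hw hdivC k
    rwa [Fin.sum_univ_three, hc] at h
  -- the linearised equations in Fourier variables
  have hE' : ∀ x, Torus.linearizedNSOperator ν U w q x = 0 := fun x => by
    have h := hE x
    rwa [zero_smul, sub_zero, Pi.zero_apply] at h
  have hEq : ∀ k p, -((ν * (4 * Real.pi ^ 2 * freqNormSq k) : ℝ) : ℂ) * c k p -
      (transportSym (fun j m => a m j) (fun m => c m p) k + transportSym (fun j m => c m j) (fun m => a m p) k) -
      2 * Real.pi * I * Q k * (k p : ℂ) = 0 := by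
    intro k p
    have h := fourier_eq_of_linearizedNSOperator_eq_zero hU hw hq hE' k p
    rwa [ha, hc, hQ] at h
  have hN1 : ∀ k p, transportSym (fun j m => a m j) (fun m => c m p) k =
      dsym 0 k * (z * c (k - e) p + conj z * c (k + e) p) := fun k p => by
    rw [transportSym_shear_left hene he0 hsupp hdir k p, haz, hz]
  have hN2 : ∀ k, transportSym (fun j m => c m j) (fun m => a m 0) k =
      2 * Real.pi * I * (z * c (k - e) 1 - conj z * c (k + e) 1) := fun k => by
    rw [transportSym_shear_right hene he0 he1 he2 hsupp k, haz, hz]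
  have hN2' : ∀ k (p : Fin 3), p ≠ 0 → transportSym (fun j m => c m j) (fun m => a m p) k = 0 :=
    fun k p hp => transportSym_shear_right_of_ne hdir k hp
  -- `|k|²`, `|k ∓ e|²` as polynomials in the coordinates
  have hK : ∀ k : Fin 3 → ℤ,
      ((freqNormSq k : ℝ) : ℂ) = (k 0 : ℂ) ^ 2 + (k 1 : ℂ) ^ 2 + (k 2 : ℂ) ^ 2 := by
    intro k; rw [freqNormSq, Fin.sum_univ_three]; push_cast; ring
  have hKm : ∀ k : Fin 3 → ℤ, ((freqNormSq (k - e) : ℝ) : ℂ) =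
      (k 0 : ℂ) ^ 2 + ((k 1 : ℂ) - 1) ^ 2 + (k 2 : ℂ) ^ 2 := by
    intro k; rw [hK]; simp [he0, he1, he2]
  have hKp : ∀ k : Fin 3 → ℤ, ((freqNormSq (k + e) : ℝ) : ℂ) =
      (k 0 : ℂ) ^ 2 + ((k 1 : ℂ) + 1) ^ 2 + (k 2 : ℂ) ^ 2 := by
    intro k; rw [hK]; simp [he0, he1, he2]
  have hTm : ∀ k : Fin 3 → ℤ, ((k 0 : ℤ) : ℂ) * c (k - e) 0 + (((k 1 : ℤ) : ℂ) - 1) * c (k - e) 1 +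
      ((k 2 : ℤ) : ℂ) * c (k - e) 2 = 0 := by
    intro k; have h := hct (k - e); simp only [Pi.sub_apply, he0, he1, he2, sub_zero] at h; push_cast at h; exact h
  have hTp : ∀ k : Fin 3 → ℤ, ((k 0 : ℤ) : ℂ) * c (k + e) 0 + (((k 1 : ℤ) : ℂ) + 1) * c (k + e) 1 +
      ((k 2 : ℤ) : ℂ) * c (k + e) 2 = 0 := by
    intro k; have h := hct (k + e); simp only [Pi.add_apply, he0, he1, he2, add_zero] at h; push_cast at h; exact h
  -- STEP 1: the pressure symbol, the Orr–Sommerfeld recursion, `ŵ₁ = 0`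
  have hP : ∀ k : Fin 3 → ℤ, 2 * Real.pi * I * Q k * ((k 0 : ℂ) ^ 2 + (k 1 : ℂ) ^ 2 + (k 2 : ℂ) ^ 2) =
      -2 * (2 * Real.pi * I * (k 0 : ℂ)) * (z * c (k - e) 1 - conj z * c (k + e) 1) := by
    intro k
    have E0 := hEq k 0
    have E1 := hEq k 1
    have E2 := hEq k 2
    rw [hN1, hN2] at E0
    rw [hN1, hN2' k 1 one_ne_zero] at E1
    rw [hN1, hN2' k 2 (by decide)] at E2
    simp only [dsym_apply] at E0 E1 E2
    push_cast at E0 E1 E2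
    linear_combination -((k 0 : ℂ) * E0 + (k 1 : ℂ) * E1 + (k 2 : ℂ) * E2) -
      (ν : ℂ) * (4 * Real.pi ^ 2 * ((freqNormSq k : ℝ) : ℂ)) * hct k -
      2 * Real.pi * I * (k 0 : ℂ) * z * hTm k - 2 * Real.pi * I * (k 0 : ℂ) * conj z * hTp k
  have hOS : ∀ k : Fin 3 → ℤ,
      -(ν : ℂ) * (4 * Real.pi ^ 2 * ((freqNormSq k : ℝ) : ℂ)) * ((freqNormSq k : ℝ) : ℂ) * c k 1 =
      2 * Real.pi * I * (k 0 : ℂ) *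
        (z * (((freqNormSq (k - e) : ℝ) : ℂ) - 1) * c (k - e) 1 +
          conj z * (((freqNormSq (k + e) : ℝ) : ℂ) - 1) * c (k + e) 1) := by
    intro k
    have E1 := hEq k 1
    rw [hN1, hN2' k 1 one_ne_zero] at E1
    simp only [dsym_apply] at E1
    push_cast at E1
    linear_combination ((freqNormSq k : ℝ) : ℂ) * E1 + (k 1 : ℂ) * hP k +
      (2 * Real.pi * I * Q k * (k 1 : ℂ)) * hK k +
      2 * Real.pi * I * (k 0 : ℂ) * (z * c (k - e) 1 + conj z * c (k + e) 1) * hK k -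
      2 * Real.pi * I * (k 0 : ℂ) * z * c (k - e) 1 * hKm k -
      2 * Real.pi * I * (k 0 : ℂ) * conj z * c (k + e) 1 * hKp k
  have hc1 : ∀ k, c k 1 = 0 := normal_component_eq_zero hν hcr hc0 he0 z hOS
  -- STEP 2: the pressure gradient vanishes, and the tangential components follow
  have hQ0 : ∀ (k : Fin 3 → ℤ) (p : Fin 3), 2 * Real.pi * I * Q k * (k p : ℂ) = 0 := by
    intro k p
    by_cases hk : k = 0
    · rw [hk]; simp
    · have hKne : ((freqNormSq k : ℝ) : ℂ) ≠ 0 := by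
        exact_mod_cast fun h0 => hk ((Torus.freqNormSq_eq_zero_iff k).1 h0)
      have h := hP k
      rw [hc1, hc1, mul_zero, mul_zero, sub_zero, mul_zero, ← hK k] at h
      have hQk : 2 * Real.pi * I * Q k = 0 := (mul_eq_zero.1 h).resolve_right hKne
      rw [hQk, zero_mul]
  have hcp : ∀ (p : Fin 3) (k : Fin 3 → ℤ), c k p = 0 := by
    intro p
    refine component_eq_zero hν hcr hc0 he0 z p fun k => ?_
    have E := hEq k p
    have hN2p : transportSym (fun j m => c m j) (fun m => a m p) k = 0 := by
      by_cases hp : p = 0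
      · rw [hp, hN2, hc1, hc1]; ring
      · exact hN2' k p hp
    rw [hN1, hN2p, hQ0, dsym_apply] at E
    push_cast at E
    linear_combination E
  -- hence `ŵ = 0`, `w = 0`
  have hcz : ∀ k, mFourierCoeff w k = 0 := fun k => by
    rw [hc]; ext p; rw [hcp p k]; rfl
  exact hw0 (eq_zero_of_forall_mFourierCoeff_eq_zero hw.continuous hcz)

end Symbols

end KolmogorovShear

end Literature.Analysis.FluidPDE

end
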